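import Literature.NumberTheory.EllipticCurves.NeronModel
import Mathlib.AlgebraicGeometry.PullbackCarrier
import HarnessLib

/-!
# Fibre-generic points of a fibre product: the projections generise the fibres of the factors

Road W of the cell hodgecm-mathlib's r₀ programme (the (W0) birational group law on a smooth model, B-p18's
`W0-CORE-SPEC` §2, sub-leaf X1): if a point `ξ` of `X ×_S Y` lying over `s ∈ S` generises EVERY point of
`X ×_S Y` over `s` (e.g. the generic point of an irreducible special fibre), then its two projections generise
every point of `X` resp. `Y` over `s`.  Proof: for `x ∈ X` and `y ∈ Y` over `s` pick a point `z` of the fibre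
product with projections `(x, y)` (`Scheme.Pullback.exists_preimage_pullback`); `z` lies over `s`, so `ξ ⤳ z`,
and the projections are continuous (`Specializes.map`).  Pure topology of schemes; stated for an arbitrary
`pullback f g`, and then in the `Over (Spec R)` shape of the (W0) skeleton (`𝒳 ⊗ 𝒳`, closed point of a local
base ring).  THEOREMS ONLY.  [cite: BLRNeronModels1990, §4.3]

## References
* [BLRNeronModels1990] S. Bosch, W. Lütkebohmert, M. Raynaud, *Néron Models*, Springer 1990, §4.3.
* Mathlib: `AlgebraicGeometry.Scheme.Pullback.exists_preimage_pullback`, `Specializes.map`.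
-/

noncomputable section

universe u

namespace Literature.AlgebraicGeometry.Morphisms

open CategoryTheory Limits _root_.AlgebraicGeometry MonoidalCategory CartesianMonoidalCategory

/-- **Fibre-generic points project to fibre-generic points.**  For `f : X ⟶ S`, `g : Y ⟶ S`, a point `s ∈ S`
and a point `ξ ∈ X ×_S Y` over `s` that generises every point of `X ×_S Y` over `s`: for all `x ∈ X`,
`y ∈ Y` over `s`, `pr₁ ξ ⤳ x` and `pr₂ ξ ⤳ y`. [cite: BLRNeronModels1990, §4.3] -/
theorem pullback_fst_specializes_and_snd_specializes {X Y S : Scheme.{u}} (f : X ⟶ S) (g : Y ⟶ S)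
    (s : S) (ξ : ↥(pullback f g))
    (hξgen : ∀ z : ↥(pullback f g), (pullback.fst f g ≫ f).base z = s → ξ ⤳ z)
    (x : X) (hx : f.base x = s) (y : Y) (hy : g.base y = s) :
    (pullback.fst f g).base ξ ⤳ x ∧ (pullback.snd f g).base ξ ⤳ y := by
  obtain ⟨z, hzx, hzy⟩ := Scheme.Pullback.exists_preimage_pullback x y (hx.trans hy.symm)
  have hz : (pullback.fst f g ≫ f).base z = s := by
    rw [Scheme.Hom.comp_base, TopCat.comp_app, hzx, hx]
  have hξz := hξgen z hz
  exact ⟨hzx ▸ hξz.map (pullback.fst f g).base.hom.continuous,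
    hzy ▸ hξz.map (pullback.snd f g).base.hom.continuous⟩

/-- **Sub-leaf X1 of the (W0) core, in the skeleton's shape.**  For `𝒳 → Spec R` (`R` local) and a point
`ξ` of `𝒳 ⊗ 𝒳 = 𝒳 ×_R 𝒳` over the closed point which generises every point of the special fibre of
`𝒳 ⊗ 𝒳` (★ `stub_L1`: the generic point of the irreducible special fibre), both projections of `ξ` generise
every point `x` of the special fibre of `𝒳` — so `prᵢ ξ` lies in every open neighbourhood of such an `x`
(`Specializes.mem_open`).  Text = `stub_X1` of B-p18's `W0Core` work file. [cite: BLRNeronModels1990, §4.3] -/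
theorem fst_specializes_and_snd_specializes_of_specialFibre {R : Type u} [CommRing R] [IsLocalRing R]
    (𝒳 : Over (Spec (.of R))) (ξ : ↥(𝒳 ⊗ 𝒳).left)
    (_hξs : (𝒳 ⊗ 𝒳).hom.base ξ = IsLocalRing.closedPoint R)
    (hξgen : ∀ y : ↥(𝒳 ⊗ 𝒳).left, (𝒳 ⊗ 𝒳).hom.base y = IsLocalRing.closedPoint R → ξ ⤳ y)
    (x : ↥𝒳.left) (hx : 𝒳.hom.base x = IsLocalRing.closedPoint R) :
    (fst 𝒳 𝒳).left.base ξ ⤳ x ∧ (snd 𝒳 𝒳).left.base ξ ⤳ x :=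
  pullback_fst_specializes_and_snd_specializes 𝒳.hom 𝒳.hom (IsLocalRing.closedPoint R) ξ hξgen x hx x hx

end Literature.AlgebraicGeometry.Morphisms

end
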